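import Summits.QuantumFields.BalabanUV.T4Continuum.Support.NE7StrippedConstraintC2
import Summits.QuantumFields.BalabanUV.T4Continuum.Spine.NE3.FrameNormalisationAdmissibleTop
import Summits.QuantumFields.BalabanUV.T4Continuum.Spine.NE3.SupplierB8SfClassPrep
import HarnessLib

/-!
# NE7StrippedConstraintRegime — THE TWO REGIME LETTERS OF H6 DISCHARGED NEAR `0`: (F) the accumulated frame `v_{j+1}(Φ)` is unitary and `N`-periodic, (S) the stripped configuration is
# bondwise within `1∕4` of `V₀`; hence `m∘G = m∘Ψ` near `0` from the background letters of [Balaban1985Averaging] Prop. 4 alone (lineage `b2b-balaban-t4-ne7-p1`, gen 119, file H9 = ROAD-G119 §5 S1′)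

Cell `pub-balaban`, rung (B)+1 sub-cell t4, CRUX PROVER NE7 #1 (OWNER of row NE7), generation 119.
Over ✓ `Spine/NE3/FrameNormalisationAdmissibleTop.vcov_mem_unitaryUnits ∕ vcov_add_period` (row NE3: [Balaban1985RegularSpaces] Prop. 7's tower is unitary; periodicity), this lineage's
✓ `NE7AccumulatedFrameDictionary.level_dictionary` ((ii) `U̿ = expCfg(Ad_{V₀}ψ)`, (iv) `‖ψ‖ ≤ 2L^{j+1}b`), ✓ `B7Transfer.norm_exp_sub_one_le_of_le`, ✓ `AveragingDeficitFermat.eventually_smallField_chart`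
(the perturbed configuration stays (52)-regular), H5∕H6∕H8.
WHAT ([folklore]; 0 def, 0 sorry; general `d ≥ 1`, `L ≥ 2`): `relPert_mem_unitaryUnits`; **`eventually_frame_unitary_periodic`** ((F)); **`eventually_strippedCfg_near`** ((S)); and
**`reduced_objective_eq_stripped_of_regime`**: `∀ᶠ Φ → 0 in skewSub (L·tower L N j)`, `minAct(chart_{V₀}(levelQ L N j U♯ (chart_{U♯}Φ))) = minAct(chart_{V₀}(strippedConstraint L N j U♯ Φ))`
under the background letters (`U♯` unitary, `(L·tower L N j)`-periodic, `SmallField U♯ a`, `a < x`, `LevelSmall d L j x`, class smallness `LevelSmall d L j (ε∕L^{2(j+1)})`, `0 < α₀`, `C0·α₀ ≤ 1∕3`,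
`4α₀ ≤ c2′`, `pdev U♯ < α₀L^{-2(j+1)}`, room `exp(3200(d+1)²(d+4)α₀) ≤ 3∕2`) — the hypothesis `m∘G = m∘Ψ` of H3 ✓ `NE7StrippedConstraintSocket` DISCHARGED for the stripped tower.
HONEST FRAMING (page 1): composition of landed kernel theorems; background letters are HYPOTHESES (for the minimiser in `sfClass` they follow from the class radius with `α₀ = 2ε`, next file);
nothing of Bałaban's asserted; NOT (G′), NOT NE7 as a spine node; spine 0∕9; finite T⁴ rung (B)+1 — NOT infinite volume, NOT mass gap, NOT BetaPertH, NOT Clay.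
-/

set_option autoImplicit false

open scoped BigOperators Matrix Matrix.Norms.L2Operator Topology
open Filter

namespace Summit.QuantumFields.BalabanUV.T4Continuum.NE7StrippedConstraintRegime

open Literature.MathematicalPhysics.QuantumFieldTheory.Balaban1983to89
open B7Prop1Explicit B7Prop2Explicit B7Prop3Flat MatrixLog
open B7Eq92Concrete (dbavgCovIter vcov)
open B7Prop4GeneralLevels (logCovIter)
open B7Transfer (norm_exp_sub_one_le_of_le)
open T4AveragingDeficitWall (Ad IsUnitaryCfg IsSkewDir SmallField)
open T4AveragingDeficitWallBoundary (IsPeriodicCfg)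
open AveragingDeficitTransport (Ad_mem_skewAdjoint norm_Ad_of_unitary)
open AveragingDeficitTorusChart (TDir chart chartDir redN isPeriodicDir_chartDir)
open AveragingDeficitChartCalculus (relLog)
open AveragingDeficitFermat (eventually_smallField_chart)
open AveragingDeficitPeriodicCounting (IsPeriodicDir)
open AveragingDeficitTwoLevelPrep (skewSub skewPR)
open AveragingDeficitMultiLevelPrep (tower cavgIter levelQ LevelSmall tower_ne_zero)
open AveragingDeficitMultiLevelBridge (cavgIter_eq_avgIter tower_eq)
open MinimalActionSandwich (minAct)
open MinimalActionRate (sfClass SmallField.mono)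
open NE3EnergyShapes (IsUnitarySite IsPeriodicSite)
open NE3.QbarDictionary (adField)
open NE3.PairLandauB8Avg (relPert)
open NE3.FrameNormalisationAdmissibleTop (vcov_mem_unitaryUnits vcov_add_period)
open NE3.SupplierB8SfClassPrep (pdev_le_of_smallField)
open NE7AccumulatedFrameDictionary (level_dictionary)
open NE7FramedEqualsStrippedGauged (chart_eq_relPert_mul)
open NE7StrippedConstraintMap (strippedCfg strippedConstraint reduced_objective_eq_stripped)
open NE7StrippedConstraintLinearisation (norm_chartDir_le expUnit_Ad_mul)

noncomputable section

variable {d : ℕ} {n : Type} [Fintype n] [DecidableEq n]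

/-- The left perturbation of a unitary base by a skew direction is unitary: `e^{Ad_W Z}` with `Ad_W Z` skew. [folklore] -/
theorem relPert_mem_unitaryUnits {W : Site d → Fin d → (Matrix n n ℂ)ˣ} (hW : IsUnitaryCfg W) {Z : Site d → Fin d → Matrix n n ℂ} (hZ : IsSkewDir Z)
    (x : Site d) (μ : Fin d) : relPert W Z x μ ∈ unitaryUnits (Matrix n n ℂ) := by
  letI : NormedAlgebra ℚ (Matrix n n ℂ) := NormedAlgebra.restrictScalars ℚ ℝ (Matrix n n ℂ)
  rw [mem_unitaryUnits]
  show NormedSpace.exp (Ad (W x μ) (Z x μ)) ∈ unitary (Matrix n n ℂ)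
  exact NormedSpace.exp_mem_unitary_of_mem_skewAdjoint (Ad_mem_skewAdjoint (hW x μ) (hZ x μ))

section Regime

variable [Nonempty n] {L N : ℕ} [NeZero L] [NeZero N]

/-- **(F) THE ACCUMULATED FRAME OF A SMALL CHART POINT IS UNITARY AND `N`-PERIODIC** (eventually as `Φ → 0`). [folklore] -/
theorem eventually_frame_unitary_periodic (hd : 1 ≤ d) (hL : 2 ≤ L) (j : ℕ)
    {Us : Site d → Fin d → (Matrix n n ℂ)ˣ} {a x : ℝ} (hUu : IsUnitaryCfg Us) (hUP : IsPeriodicCfg Us ((L : ℤ) * (tower L N j : ℕ)))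
    (hUa : SmallField Us a) (ha : 0 ≤ a) (hax : a < x)
    {α₀ : ℝ} (hα : 0 < α₀) (hα3 : B7Prop2Explicit.C0 d * α₀ ≤ 1 / 3) (hα4 : 4 * α₀ ≤ B7Prop2Explicit.c2' d L)
    (hxα : x < α₀ * (((L : ℝ) ^ (j + 1))⁻¹) ^ 2)
    (hroom : Real.exp (4 * (800 * ((d : ℝ) + 1) ^ 2 * ((d : ℝ) + 4)) * α₀) ≤ 3 / 2) :
    ∀ᶠ Φ : ↥(skewSub d n (L * tower L N j)) in 𝓝 0,
      IsUnitarySite (vcov L Us (relPert Us (chartDir (ContinuousLinearMap.id ℝ (Matrix n n ℂ)) (L * tower L N j) (Φ : TDir d n (L * tower L N j)))) (j + 1)) ∧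
      IsPeriodicSite (vcov L Us (relPert Us (chartDir (ContinuousLinearMap.id ℝ (Matrix n n ℂ)) (L * tower L N j) (Φ : TDir d n (L * tower L N j)))) (j + 1)) (N : ℤ) := by
  haveI : NeZero (L * tower L N j) := ⟨Nat.mul_ne_zero (NeZero.ne L) (tower_ne_zero L N j)⟩
  have h52 : B7Prop2Explicit.pdev Us < α₀ * (((L : ℝ) ^ (j + 1))⁻¹) ^ 2 := (pdev_le_of_smallField ha hUa).trans_lt (hax.trans hxα)
  have eM : (((L * tower L N j : ℕ)) : ℤ) = (L : ℤ) * (tower L N j : ℕ) := by push_cast; ring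
  have hUPM : IsPeriodicCfg Us (((L * tower L N j : ℕ)) : ℤ) := by rw [eM]; exact hUP
  -- the perturbed configuration stays in the plaquette class `x` near `0`
  have hι : Tendsto (fun Φ : ↥(skewSub d n (L * tower L N j)) => (Φ : TDir d n (L * tower L N j))) (𝓝 0) (𝓝 0) := by
    have h := (skewSub d n (L * tower L N j)).subtypeL.continuous.tendsto (0 : ↥(skewSub d n (L * tower L N j)))
    rw [map_zero] at h; exact h
  have hsf : ∀ᶠ Φ : ↥(skewSub d n (L * tower L N j)) in 𝓝 0,
      SmallField (chart (ContinuousLinearMap.id ℝ (Matrix n n ℂ)) (L * tower L N j) Us (Φ : TDir d n (L * tower L N j))) x :=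
    hι.eventually (eventually_smallField_chart (ContinuousLinearMap.id ℝ (Matrix n n ℂ)) (L * tower L N j) hUPM hax hUa)
  -- the sup of the direction is small near `0`
  have hLp : 0 < (L : ℝ) ^ (j + 1) := by positivity
  have hc3 : 0 < B7Prop3Flat.c3 d L := by unfold B7Prop3Flat.c3; positivity
  have hρ0 : (0 : ℝ) < min (1 / (24 * (131072 * ((d : ℝ) + 1) ^ 2) * (L : ℝ) ^ (j + 1)))
      (min (B7Prop3Flat.c3 d L / (2 * (L : ℝ) ^ (j + 1))) (1 / (2048 * (d : ℝ) * (L : ℝ) ^ (j + 1)))) := by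
    have : (0 : ℝ) < d := by exact_mod_cast hd
    positivity
  have hnorm := eventually_norm_sub_lt (0 : ↥(skewSub d n (L * tower L N j))) hρ0
  filter_upwards [hsf, hnorm] with Φ hΦx hΦn
  rw [sub_zero] at hΦn
  have hd0 : (0 : ℝ) < d := by exact_mod_cast hd
  have h1 : ‖Φ‖ ≤ 1 / (24 * (131072 * ((d : ℝ) + 1) ^ 2) * (L : ℝ) ^ (j + 1)) := hΦn.le.trans (min_le_left _ _)
  have h2 : ‖Φ‖ ≤ B7Prop3Flat.c3 d L / (2 * (L : ℝ) ^ (j + 1)) := hΦn.le.trans ((min_le_right _ _).trans (min_le_left _ _))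
  have h3 : ‖Φ‖ ≤ 1 / (2048 * (d : ℝ) * (L : ℝ) ^ (j + 1)) := hΦn.le.trans ((min_le_right _ _).trans (min_le_right _ _))
  have hΦ0 : 0 ≤ ‖Φ‖ := norm_nonneg _
  set Z := chartDir (ContinuousLinearMap.id ℝ (Matrix n n ℂ)) (L * tower L N j) (Φ : TDir d n (L * tower L N j)) with hZ
  have hZs : IsSkewDir Z := fun y κ => Φ.2 (redN (L * tower L N j) y) κ
  have hBu : ∀ (y : Site d) (κ : Fin d), expCfg (adField Us Z) y κ ∈ unitaryUnits (Matrix n n ℂ) :=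
    fun y κ => relPert_mem_unitaryUnits hUu hZs y κ
  have hBb : ∀ (y : Site d) (κ : Fin d), ‖adField Us Z y κ‖ ≤ ‖Φ‖ := fun y κ => by
    unfold adField; rw [norm_Ad_of_unitary (hUu y κ)]; exact norm_chartDir_le _ y κ
  have hsmall : Real.exp (4 * (800 * ((d : ℝ) + 1) ^ 2 * ((d : ℝ) + 4)) * α₀) * (1 + 8 * (131072 * ((d : ℝ) + 1) ^ 2) * ((L : ℝ) ^ (j + 1) * ‖Φ‖)) ≤ 2 := by
    have hC : 0 < 24 * (131072 * ((d : ℝ) + 1) ^ 2) * (L : ℝ) ^ (j + 1) := by positivity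
    have ht : 8 * (131072 * ((d : ℝ) + 1) ^ 2) * ((L : ℝ) ^ (j + 1) * ‖Φ‖) ≤ 1 / 3 := by
      have := (le_div_iff₀ hC).mp h1; nlinarith
    calc Real.exp (4 * (800 * ((d : ℝ) + 1) ^ 2 * ((d : ℝ) + 4)) * α₀) * (1 + 8 * (131072 * ((d : ℝ) + 1) ^ 2) * ((L : ℝ) ^ (j + 1) * ‖Φ‖))
        ≤ (3 / 2) * (1 + 1 / 3) := mul_le_mul hroom (by linarith) (by positivity) (by norm_num)
      _ = 2 := by norm_num
  have hc₃ : 2 * ((L : ℝ) ^ (j + 1) * ‖Φ‖) ≤ B7Prop3Flat.c3 d L := by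
    have := (le_div_iff₀ (by positivity : (0 : ℝ) < 2 * (L : ℝ) ^ (j + 1))).mp h2; nlinarith
  have hsm : 2048 * (d : ℝ) * ((L : ℝ) ^ (j + 1) * ‖Φ‖) ≤ 1 := by
    have := (le_div_iff₀ (by positivity : (0 : ℝ) < 2048 * (d : ℝ) * (L : ℝ) ^ (j + 1))).mp h3; nlinarith
  -- the perturbed configuration `relPert · U♯ = chart Φ` is (52)-regular with the same `α₀`
  have hα2 : 2 * α₀ ≤ B7Prop2Explicit.c2' d L := by linarith
  have hx0 : 0 ≤ x := ha.trans hax.le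
  have hP : B7Prop2Explicit.pdev (expCfg (adField Us Z) * Us) < α₀ * (((L : ℝ) ^ (j + 1))⁻¹) ^ 2 := by
    have e : expCfg (adField Us Z) * Us = chart (ContinuousLinearMap.id ℝ (Matrix n n ℂ)) (L * tower L N j) Us (Φ : TDir d n (L * tower L N j)) := by
      rw [chart_eq_relPert_mul]; rfl
    rw [e]
    exact (pdev_le_of_smallField hx0 hΦx).trans_lt hxα
  have hrel : relPert Us Z = expCfg (adField Us Z) := rfl
  refine ⟨fun z => ?_, fun z i => ?_⟩
  · rw [hrel]
    exact vcov_mem_unitaryUnits hd hL hUu hBu hα hα3 hα4 h52 hΦ0 hBb hsmall hc₃ hsm hα hα3 hα2 hP z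
  · -- periodicity of the accumulated frame with period `N` from period `N·L^{j+1}` of the data
    have hper : N * L ^ (j + 1) = L * tower L N j := by rw [tower_eq]; ring
    have hU₀ : ∀ (y : Site d) (κ : Fin d) (i : Fin d), Us (y + ((N * L ^ (j + 1) : ℕ) : ℤ) • e i) κ = Us y κ := fun y κ i => by
      rw [hper, eM]; exact hUP y i κ
    have hZP : IsPeriodicDir Z (((L * tower L N j : ℕ)) : ℤ) := isPeriodicDir_chartDir (ContinuousLinearMap.id ℝ (Matrix n n ℂ)) (L * tower L N j) _
    have hZP' : IsPeriodicDir Z (((N * L ^ (j + 1) : ℕ)) : ℤ) := by rw [hper]; exact hZP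
    have hU₁ : ∀ (y : Site d) (κ : Fin d) (i : Fin d),
        relPert Us Z (y + ((N * L ^ (j + 1) : ℕ) : ℤ) • e i) κ = relPert Us Z y κ := fun y κ i => by
      unfold relPert
      rw [hU₀ y κ i, hZP' y i κ]
    exact vcov_add_period L N (j + 1) hU₀ hU₁ z i

/-- **(S) THE STRIPPED CONFIGURATION IS BONDWISE NEAR `V₀`** (eventually as `Φ → 0`): `‖V₀(b)⁻¹·(U̿^{j+1}(Φ)·V₀)(b) − 1‖ ≤ 1∕4` on the top torus. [folklore] -/
theorem eventually_strippedCfg_near (hL : 2 ≤ L) (j : ℕ)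
    {Us : Site d → Fin d → (Matrix n n ℂ)ˣ} (hUu : IsUnitaryCfg Us)
    {α₀ : ℝ} (hα : 0 < α₀) (hα3 : B7Prop2Explicit.C0 d * α₀ ≤ 1 / 3) (hα4 : 4 * α₀ ≤ B7Prop2Explicit.c2' d L)
    (h52 : B7Prop2Explicit.pdev Us < α₀ * (((L : ℝ) ^ (j + 1))⁻¹) ^ 2)
    (hroom : Real.exp (4 * (800 * ((d : ℝ) + 1) ^ 2 * ((d : ℝ) + 4)) * α₀) ≤ 3 / 2) :
    ∀ᶠ Φ : ↥(skewSub d n (L * tower L N j)) in 𝓝 0, ∀ (r : Fin d → Fin N) (κ : Fin d),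
      ‖((((cavgIter L (j + 1) Us) (boxVec N r) κ)⁻¹ : (Matrix n n ℂ)ˣ) : Matrix n n ℂ)
        * (strippedCfg L j Us (Φ : TDir d n (L * tower L N j)) (boxVec N r) κ : Matrix n n ℂ) - 1‖ ≤ 1 / 4 := by
  haveI : NeZero (L * tower L N j) := ⟨Nat.mul_ne_zero (NeZero.ne L) (tower_ne_zero L N j)⟩
  have hLp : 0 < (L : ℝ) ^ (j + 1) := by positivity
  have hc3 : 0 < B7Prop3Flat.c3 d L := by unfold B7Prop3Flat.c3; positivity
  have hρ0 : (0 : ℝ) < min (1 / (24 * (131072 * ((d : ℝ) + 1) ^ 2) * (L : ℝ) ^ (j + 1)))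
      (min (B7Prop3Flat.c3 d L / (2 * (L : ℝ) ^ (j + 1))) (1 / (16 * (L : ℝ) ^ (j + 1)))) := by positivity
  refine (eventually_norm_sub_lt (0 : ↥(skewSub d n (L * tower L N j))) hρ0).mono fun Φ hΦn r κ => ?_
  rw [sub_zero] at hΦn
  have h1 : ‖Φ‖ ≤ 1 / (24 * (131072 * ((d : ℝ) + 1) ^ 2) * (L : ℝ) ^ (j + 1)) := hΦn.le.trans (min_le_left _ _)
  have h2 : ‖Φ‖ ≤ B7Prop3Flat.c3 d L / (2 * (L : ℝ) ^ (j + 1)) := hΦn.le.trans ((min_le_right _ _).trans (min_le_left _ _))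
  have h3 : ‖Φ‖ ≤ 1 / (16 * (L : ℝ) ^ (j + 1)) := hΦn.le.trans ((min_le_right _ _).trans (min_le_right _ _))
  have hΦ0 : 0 ≤ ‖Φ‖ := norm_nonneg _
  have hXb : ∀ (y : Site d) (κ' : Fin d), ‖chartDir (ContinuousLinearMap.id ℝ (Matrix n n ℂ)) (L * tower L N j) (Φ : TDir d n (L * tower L N j)) y κ'‖ ≤ ‖Φ‖ :=
    fun y κ' => norm_chartDir_le _ y κ'
  have hsmall : Real.exp (4 * (800 * ((d : ℝ) + 1) ^ 2 * ((d : ℝ) + 4)) * α₀) * (1 + 8 * (131072 * ((d : ℝ) + 1) ^ 2) * ((L : ℝ) ^ (j + 1) * ‖Φ‖)) ≤ 2 := by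
    have hC : 0 < 24 * (131072 * ((d : ℝ) + 1) ^ 2) * (L : ℝ) ^ (j + 1) := by positivity
    have ht : 8 * (131072 * ((d : ℝ) + 1) ^ 2) * ((L : ℝ) ^ (j + 1) * ‖Φ‖) ≤ 1 / 3 := by
      have := (le_div_iff₀ hC).mp h1; nlinarith
    calc Real.exp (4 * (800 * ((d : ℝ) + 1) ^ 2 * ((d : ℝ) + 4)) * α₀) * (1 + 8 * (131072 * ((d : ℝ) + 1) ^ 2) * ((L : ℝ) ^ (j + 1) * ‖Φ‖))
        ≤ (3 / 2) * (1 + 1 / 3) := mul_le_mul hroom (by linarith) (by positivity) (by norm_num)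
      _ = 2 := by norm_num
  have hc₃ : 2 * ((L : ℝ) ^ (j + 1) * ‖Φ‖) ≤ B7Prop3Flat.c3 d L := by
    have := (le_div_iff₀ (by positivity : (0 : ℝ) < 2 * (L : ℝ) ^ (j + 1))).mp h2; nlinarith
  have hsup : 2 * ((L : ℝ) ^ (j + 1) * ‖Φ‖) ≤ 1 / 8 := by
    have := (le_div_iff₀ (by positivity : (0 : ℝ) < 16 * (L : ℝ) ^ (j + 1))).mp h3; nlinarith
  obtain ⟨-, hii, -, hiv, -⟩ := level_dictionary (d := d) (n := n) hL (j + 1) hUu hα hα3 hα4 h52 hΦ0 hXb hsmall hc₃ (j + 1) le_rfl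
  have hcfg : strippedCfg L j Us (Φ : TDir d n (L * tower L N j)) (boxVec N r) κ
      = avgIter L Us (j + 1) (boxVec N r) κ * expUnit (Ad (avgIter L Us (j + 1) (boxVec N r) κ)⁻¹
          (logCovIter L Us (adField Us (chartDir (ContinuousLinearMap.id ℝ (Matrix n n ℂ)) (L * tower L N j) (Φ : TDir d n (L * tower L N j)))) (j + 1) (boxVec N r) κ)) := by
    show dbavgCovIter L Us (relPert Us (chartDir (ContinuousLinearMap.id ℝ (Matrix n n ℂ)) (L * tower L N j) (Φ : TDir d n (L * tower L N j)))) (j + 1) (boxVec N r) κ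
        * cavgIter L (j + 1) Us (boxVec N r) κ = _
    rw [hii, cavgIter_eq_avgIter]
    exact expUnit_Ad_mul _ _
  rw [hcfg, cavgIter_eq_avgIter, Units.val_mul, ← mul_assoc, Units.inv_mul, one_mul, val_expUnit]
  have hψ := (hiv (boxVec N r) κ).trans hsup
  calc _ ≤ Real.exp (1 / 8) - 1 := norm_exp_sub_one_le_of_le _ hψ
    _ ≤ 1 / 4 := by
      have h := Real.abs_exp_sub_one_le (x := (1 / 8 : ℝ)) (by rw [abs_of_nonneg (by norm_num)]; norm_num)
      rw [abs_of_nonneg (by norm_num : (0 : ℝ) ≤ 1 / 8)] at h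
      linarith [le_abs_self (Real.exp (1 / 8) - 1)]

/-- **THE REDUCED OBJECTIVE OF THE FRAMED CONSTRAINT IS THAT OF THE STRIPPED CONSTRAINT, FROM THE BACKGROUND LETTERS ALONE** (H6 ✓ `reduced_objective_eq_stripped` with (F) and (S) discharged):
eventually as `Φ → 0`, `minAct(chart_{V₀}(levelQ L N j U♯ (chart_{U♯}Φ))) = minAct(chart_{V₀}(strippedConstraint L N j U♯ Φ))`. [folklore] -/
theorem reduced_objective_eq_stripped_of_regime (hd : 1 ≤ d) (hL : 2 ≤ L) {ε : ℝ} (hε : 0 ≤ ε) (j : ℕ)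
    (hsε : LevelSmall d L j (ε / ((L : ℝ) ^ (j + 1)) ^ 2))
    {Us : Site d → Fin d → (Matrix n n ℂ)ˣ} {a x : ℝ} (hUu : IsUnitaryCfg Us) (hUP : IsPeriodicCfg Us ((L : ℤ) * (tower L N j : ℕ)))
    (hUa : SmallField Us a) (ha : 0 ≤ a) (hax : a < x) (hs : LevelSmall d L j x)
    {α₀ : ℝ} (hα : 0 < α₀) (hα3 : B7Prop2Explicit.C0 d * α₀ ≤ 1 / 3) (hα4 : 4 * α₀ ≤ B7Prop2Explicit.c2' d L)
    (hxα : x < α₀ * (((L : ℝ) ^ (j + 1))⁻¹) ^ 2)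
    (hroom : Real.exp (4 * (800 * ((d : ℝ) + 1) ^ 2 * ((d : ℝ) + 4)) * α₀) ≤ 3 / 2) :
    ∀ᶠ Φ : ↥(skewSub d n (L * tower L N j)) in 𝓝 0,
      minAct d (sfClass d L N ε) L N (j + 1) (chart (ContinuousLinearMap.id ℝ (Matrix n n ℂ)) N (cavgIter L (j + 1) Us)
          ((levelQ L N j Us (chart (ContinuousLinearMap.id ℝ (Matrix n n ℂ)) (L * tower L N j) Us (Φ : TDir d n (L * tower L N j)))) : TDir d n N))
        = minAct d (sfClass d L N ε) L N (j + 1) (chart (ContinuousLinearMap.id ℝ (Matrix n n ℂ)) N (cavgIter L (j + 1) Us)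
          ((strippedConstraint L N j Us Φ : ↥(skewSub d n N)) : TDir d n N)) := by
  have hL1 : 1 ≤ L := le_trans (by norm_num) hL
  have hx : 0 ≤ x := ha.trans hax.le
  have h52 : B7Prop2Explicit.pdev Us < α₀ * (((L : ℝ) ^ (j + 1))⁻¹) ^ 2 := (pdev_le_of_smallField ha hUa).trans_lt (hax.trans hxα)
  exact reduced_objective_eq_stripped (N := N) hL1 hε j hsε hUu hUP hUa hax hx hs
    (eventually_frame_unitary_periodic (N := N) hd hL j hUu hUP hUa ha hax hα hα3 hα4 hxα hroom)
    (eventually_strippedCfg_near (N := N) hL j hUu hα hα3 hα4 h52 hroom)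

end Regime

end

end Summit.QuantumFields.BalabanUV.T4Continuum.NE7StrippedConstraintRegime
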